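import Mathlib
import HarnessLib
import Summits.HubbardSuperconductivity.HubbardSuperconductivity.Theorems.KLProgrammeKLRegimeEnginePairTransferMemberSplitCells

/-!
# Route `KLProgramme` — ENGINE stmt-HubbardSuperconductivity-20437 `KLRegimeEngineV17F2`, row (c) value lane «(c)-OUT»: the MEMBER signed PH rows under the CELL SPLIT
# `V_j⊗V_j = c + F₁ + Σ_w F₂ʷ` with the constant part booked IN THE SAME (angular-cell, sharp-TC) ROW SHAPE, so that the `c`- and `F₁`-rows ADD
# (brick (L4)-1′ of cure (A″) route 3′ of located «(c)-OUT-COOPER-ANTIPODE»; cell gate-hubbard-kl, seat hubbard-kl-k3c2-p2 g26)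

`member_*_signed_le_splitCells` (…MemberSplitCells) books the constant `c` through the landed row `klmsRowBound (2‖c‖) 0` and `F₁` through `klmsRowBoundTCC`; the forward-window
head adds the two rows (`klmsRowBound_add` in …OutClassForwardQuarterSplit3), which needs ONE shape.  Here the constant is booked through `klms_member_*_signed_le_genTCC` as well
(constant pin: global constant `0`, cell constants `0` on the SAME cell family), and the two rows are pre-added:
* `klmsRowBoundTCC_add` (the row is linear in `(A₀, K_g, I₁, I_δ)`), `klmsRowBoundTCC_zero_cells` (the constant pin's arc sums vanish);
* **`member_direct_signed_le_splitCellsC`**, **`member_crossed_signed_le_splitCellsC`** — conclusion with the COMBINED row `klmsRowBoundTCC (2‖c‖ + A₁) K_g I₁ I_δ` (crossed: `‖c‖ + A₁`)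
  + `ε₁`·flat + the window family.
Pure composition; the split and its data are binders; nothing asserts (X).3, (c), K3 or superconductivity.  0 kit · 0 lit.
-/

noncomputable section

namespace Summit.HubbardSuperconductivity.HubbardSuperconductivity.Theorems.KLRegimeSplit

set_option linter.dupNamespace false -- summit = problem name (single-conjunct summit), D-0017

open Real Set Finset Complex Literature.MathematicalPhysics.QuantumLattice
open Literature.Probability.LatticeModels hiding torusSupNorm
open Literature.MathematicalPhysics.QuantumLattice.BandSectorCounting
open Summit.HubbardSuperconductivity.HubbardSuperconductivity.Theorems.KLProgrammeLegKernels
open Summit.HubbardSuperconductivity.HubbardSuperconductivity.Theorems.KLRegimeWick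
open Summit.HubbardSuperconductivity.HubbardSuperconductivity.Theorems.TwoPointAssembly
open Summit.HubbardSuperconductivity.HubbardSuperconductivity.Theorems.DispersionFlow
open Summit.HubbardSuperconductivity.HubbardSuperconductivity.Theorems.PerturbedFermiCurve
open Summit.HubbardSuperconductivity.HubbardSuperconductivity.Theorems.EngineV8

variable {L M : ℕ} [NeZero L] [NeZero M] (β μ : ℝ) (K : TrigPolyC4v)

section Model

variable {a' b' : ℝ} (B : BandBounds a' b') {R : RenConsts} {U : ℝ} {N : ℕ} {A : ℝ}

/-! ## §1 Row algebra -/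

/-- **The angular-cell row bound is additive in its data** `(A₀, K_g, I₁, I_δ)`. -/
theorem klmsRowBoundTCC_add (d A G A₀ Kg I₁ Iδ A₀' Kg' I₁' Iδ' β : ℝ) (n j : ℕ) (δ : ℝ) (L : ℕ) :
    klmsRowBoundTCC d A G A₀ Kg I₁ Iδ β n j δ L + klmsRowBoundTCC d A G A₀' Kg' I₁' Iδ' β n j δ L =
      klmsRowBoundTCC d A G (A₀ + A₀') (Kg + Kg') (I₁ + I₁') (Iδ + Iδ') β n j δ L := by
  unfold klmsRowBoundTCC
  ring

/-- The arc sums of the constant pin (cell constants `0`, global constant `0`) vanish. -/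
theorem klmsRowBoundTCC_zero_cells {ι : Type*} [Fintype ι] (αc βc : ι → ℝ) (L : ℕ) (d A G A₀ β : ℝ) (n j : ℕ) (δ : ℝ) :
    klmsRowBoundTCC d A G A₀ 0 (∑ c, (fun _ : ι => (0 : ℝ)) c * (βc c - αc c))
        (∑ c, (2 * (fun _ : ι => (0 : ℝ)) c + 4 * 0) * (Real.pi / L) * (βc c - αc c)) β n j δ L =
      klmsRowBoundTCC d A G A₀ 0 0 0 β n j δ L := by
  simp only [zero_mul, mul_zero, add_zero, Finset.sum_const_zero]

/-! ## §2 The member rows under the cell split, combined row -/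

/-- **MEMBER DIRECT ROW, CELL SPLIT `V_j⊗V_j = c + F₁ + Σ_w F₂ʷ`** (`n+1 ≤ j`, window `G|p_{x−y}| ≤ Λₙ₊₁/8`): `c` constant (booked in the same row shape), `F₁` with
data `(A₁, K_g, angular cells, ε₁)` against its pin `F₁₀`, a finite window family `F₂ʷ` ⟹ `‖S_Φ‖ ≤ c-row + (F₁-row(cells) + ε₁·flat) +
Σ_w A₂ʷ·(512/3)(βL²)²/Λ(t)²·(2·(15381(ρ_w/π + 1/L)·Λₙ·βL²))` (the running member symbol is soft at scale `n`). -/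
theorem member_direct_signed_le_splitCellsC (hR : ∀ j, 0 ≤ R.Gfr j) (hK : FrameOK R U N μ K)
    (hAb : ∀ p : Momentum, ∀ j ≤ 2, ‖iteratedFDeriv ℝ j (frameShift K) p‖ ≤ A) (hA : 4 * A < B.Dtmin) (hA20 : 4 * A ≤ 1 / 20) (hμ : μ ≤ -0.15)
    (n : ℕ) {t : ℝ} (ht : t ∈ Icc (0 : ℝ) 1) (hβ : klBetaMin ≤ β) (hβL : β ≤ L) (hn : n + 1 ≤ nScales β + 1)
    (hM : β * (4 * klScale klE0 (n + 1)) / (2 * Real.pi) + 1 ≤ M)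
    (Φ : ℕ → ℝ → FreqMomentum L M → ℝ) (hΦ : Φ = fun j t k => (softSymbolCompl L M β μ K (n + 1) j) k + (hubbardCutoffWeightCT L M β μ K (klScale klE0 (n + 1)) k -
            hubbardCutoffWeightCT L M β μ K (klScale klE0 n + t * (klScale klE0 (n + 1) - klScale klE0 n)) k))
    (Wd : ℝ → FreqMomentum L M → ℝ) (hWd : Wd = fun t k => deriv (fun Λ' : ℝ => hubbardCutoffWeightCT L M β μ K Λ' k) (klScale klE0 n + t * (klScale klE0 (n + 1) - klScale klE0 n)))
    (V : ℕ → ℝ → (Fin 4 → HubbardFieldIdx L M) → ℂ) {j : ℕ} (hj : n + 1 ≤ j) (Qm x y : TorusSite 2 L)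
    (hlo : a' < μ - 4 * klScale klE0 (n + 1) - 4 * A) (hhi : μ + 4 * klScale klE0 (n + 1) + 4 * A < b')
    (hq : (4 + 8 / 3 * R.Gfr 1 * U ^ 2) * klTorusNorm L (x - y) ≤ klScale klE0 (n + 1) / 8)
    (c : ℂ) (F₁ : FreqMomentum L M → Fin 2 → FreqMomentum L M → ℂ) {ι' : Type*} [Fintype ι'] (F₂ : ι' → FreqMomentum L M → Fin 2 → FreqMomentum L M → ℂ)
    (F₁₀ : TorusSite 2 L → Fin 2 → TorusSite 2 L → ℂ)
    (hsplit : ∀ (p : FreqMomentum L M) (σ : Fin 2) (p' : FreqMomentum L M),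
      V j t ![((p, σ), 1), ((p', σ), 0), (((omega0 M, y), 0), 0), (((omega0 M, x), 0), 1)] *
          V j t ![((p, σ), 0), ((p', σ), 1), ((((omega0 M).rev, Qm - y), 1), 0), ((((omega0 M).rev, Qm - x), 1), 1)] = c + F₁ p σ p' + ∑ w, F₂ w p σ p')
    {A₁ Kg ε₁ : ℝ} (hA1 : 0 ≤ A₁) (hKg : 0 ≤ Kg) (hε1 : 0 ≤ ε₁)
    (hY0p₁ : ∀ k : TorusSite 2 L, ‖∑ σ : Fin 2, F₁₀ k σ (k + (x - y))‖ ≤ A₁)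
    (hY1p₁ : ∀ k k' : TorusSite 2 L, ‖(∑ σ : Fin 2, F₁₀ k σ (k + (x - y))) - ∑ σ : Fin 2, F₁₀ k' σ (k' + (x - y))‖ ≤ Kg * klTorusNorm L (k - k'))
    (hY0m₁ : ∀ k : TorusSite 2 L, ‖∑ σ : Fin 2, F₁₀ (k + -(x - y)) σ k‖ ≤ A₁)
    (hY1m₁ : ∀ k k' : TorusSite 2 L, ‖(∑ σ : Fin 2, F₁₀ (k + -(x - y)) σ k) - ∑ σ : Fin 2, F₁₀ (k' + -(x - y)) σ k'‖ ≤ Kg * klTorusNorm L (k - k'))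
    {ι : Type*} [Fintype ι] {S : ι → Finset (TorusSite 2 L)} {αc βc Lc : ι → ℝ} (hαβ : ∀ c, αc c ≤ βc c) (hLc : ∀ c, 0 ≤ Lc c)
    {r : ℝ} (hr : 4 * klScale klE0 (n + 1) / (B.Dtmin - 4 * A) + Real.pi / L ≤ r)
    (hserve : ∀ c, ∀ θ ∈ Icc (αc c) (βc c), ∀ k : TorusSite 2 L,
      torusSupNorm (klpeP L k -
        (perturbedFermiRadius (fun k : Fin 2 → ℝ => frameShift K (WithLp.toLp 2 k)) μ θ * Real.cos θ,
          perturbedFermiRadius (fun k : Fin 2 → ℝ => frameShift K (WithLp.toLp 2 k)) μ θ * Real.sin θ)) ≤ r → k ∈ S c)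
    (hcover : ∀ θ ∈ Ioo (-π) π, ∃ c, θ ∈ Icc (αc c) (βc c))
    (hcellp : ∀ c, ∀ k ∈ S c, ∀ k' ∈ S c, ‖(∑ σ : Fin 2, F₁₀ k σ (k + (x - y))) - ∑ σ : Fin 2, F₁₀ k' σ (k' + (x - y))‖ ≤ Lc c * klTorusNorm L (k - k'))
    (hcellm : ∀ c, ∀ k ∈ S c, ∀ k' ∈ S c, ‖(∑ σ : Fin 2, F₁₀ (k + -(x - y)) σ k) - ∑ σ : Fin 2, F₁₀ (k' + -(x - y)) σ k'‖ ≤ Lc c * klTorusNorm L (k - k'))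
    (hflat₁ : ∀ (i : MatsubaraIdx M) (σ : Fin 2) (k k' : TorusSite 2 L), matsubaraFreq β M i ^ 2 ≤ (4 * klScale klE0 (n + 1)) ^ 2 →
      ‖F₁ (i, k) σ (i, k') - F₁₀ k σ k'‖ ≤ ε₁)
    (cen : ι' → TorusSite 2 L) {ρ A₂ : ι' → ℝ} (hρ : ∀ w, 0 ≤ ρ w) (hA2 : ∀ w, 0 ≤ A₂ w)
    (hF₂ : ∀ w (p : FreqMomentum L M) (σ : Fin 2) (p' : FreqMomentum L M), ‖F₂ w p σ p'‖ ≤ A₂ w)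
    (hsupp₂ : ∀ w (p : FreqMomentum L M) (σ : Fin 2) (p' : FreqMomentum L M), ρ w < klTorusNorm L (p.2 - cen w) → F₂ w p σ p' = 0) :
    ‖∑ p : FreqMomentum L M, ∑ σ : Fin 2, ∑ p' : FreqMomentum L M,
        if matsubaraInt M p'.1 + matsubaraInt M (omega0 M) = matsubaraInt M p.1 + matsubaraInt M (omega0 M) ∧ p'.2 = p.2 + x - y then
          ((((((Φ j t p) : ℝ) : ℂ) * (((β * (L : ℝ) ^ 2 : ℝ) : ℂ) * propCT L M β μ K p)) * ((((Wd t p') : ℝ) : ℂ) * (((β * (L : ℝ) ^ 2 : ℝ) : ℂ) * propCT L M β μ K p'))) +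
              (((((Wd t p) : ℝ) : ℂ) * (((β * (L : ℝ) ^ 2 : ℝ) : ℂ) * propCT L M β μ K p)) * ((((Φ j t p') : ℝ) : ℂ) * (((β * (L : ℝ) ^ 2 : ℝ) : ℂ) * propCT L M β μ K p')))) *
            (V j t ![((p, σ), 1), ((p', σ), 0), (((omega0 M, y), 0), 0), (((omega0 M, x), 0), 1)] *
              V j t ![((p, σ), 0), ((p', σ), 1), ((((omega0 M).rev, Qm - y), 1), 0), ((((omega0 M).rev, Qm - x), 1), 1)])
        else 0‖ ≤
      ((β * (L : ℝ) ^ 2) ^ 2 *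
          (β * (L : ℝ) ^ 2 * klmsRowBoundTCC B.Dtmin A (4 + 8 / 3 * R.Gfr 1 * U ^ 2) (2 * ‖c‖ + A₁) Kg (∑ c, Lc c * (βc c - αc c))
              (∑ c, (2 * Lc c + 4 * Kg) * (Real.pi / L) * (βc c - αc c)) β n j ((4 + 8 / 3 * R.Gfr 1 * U ^ 2) * klTorusNorm L (x - y)) L +
            β * (L : ℝ) ^ 2 * klmsRowBoundTCC B.Dtmin A (4 + 8 / 3 * R.Gfr 1 * U ^ 2) (2 * ‖c‖ + A₁) Kg (∑ c, Lc c * (βc c - αc c))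
              (∑ c, (2 * Lc c + 4 * Kg) * (Real.pi / L) * (βc c - αc c)) β n j ((4 + 8 / 3 * R.Gfr 1 * U ^ 2) * klTorusNorm L (x - y)) L) +
        ε₁ * (512 / 3 * (β * (L : ℝ) ^ 2) ^ 2 / (klScale klE0 n + t * (klScale klE0 (n + 1) - klScale klE0 n)) ^ 2 *
          ∑ p : FreqMomentum L M, |Φ j t p| * ‖propCT L M β μ K p‖)) +
      ∑ w, A₂ w * (512 / 3 * (β * (L : ℝ) ^ 2) ^ 2 / (klScale klE0 n + t * (klScale klE0 (n + 1) - klScale klE0 n)) ^ 2 *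
        (2 * (15381 * (ρ w / π + ((L : ℝ))⁻¹) * klScale klE0 n * β * (L : ℝ) ^ 2))) := by
  -- (1) split the kernel twice
  set P : FreqMomentum L M → FreqMomentum L M → Prop := fun p p' =>
    matsubaraInt M p'.1 + matsubaraInt M (omega0 M) = matsubaraInt M p.1 + matsubaraInt M (omega0 M) ∧ p'.2 = p.2 + x - y with hP
  set ln : FreqMomentum L M → FreqMomentum L M → ℂ := fun p p' =>
    (((((Φ j t p) : ℝ) : ℂ) * (((β * (L : ℝ) ^ 2 : ℝ) : ℂ) * propCT L M β μ K p)) * ((((Wd t p') : ℝ) : ℂ) * (((β * (L : ℝ) ^ 2 : ℝ) : ℂ) * propCT L M β μ K p'))) +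
      (((((Wd t p) : ℝ) : ℂ) * (((β * (L : ℝ) ^ 2 : ℝ) : ℂ) * propCT L M β μ K p)) * ((((Φ j t p') : ℝ) : ℂ) * (((β * (L : ℝ) ^ 2 : ℝ) : ℂ) * propCT L M β μ K p'))) with hln
  have e := (((pinned_direct_sum_kernel_congr P ln hsplit).trans (pinned_direct_sum_kernel_add P ln (fun p σ p' => c + F₁ p σ p') (fun p σ p' => ∑ w, F₂ w p σ p'))).trans
    (congrArg (· + _) (pinned_direct_sum_kernel_add P ln (fun _ _ _ => c) F₁))).trans (congrArg (_ + ·) (pinned_direct_sum_kernel_sum P ln F₂))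
  simp only [hP, hln] at e
  rw [e]
  -- (2) the three rows
  have h2c : ∀ k : TorusSite 2 L, ‖∑ _σ : Fin 2, (fun (_ : TorusSite 2 L) (_ : Fin 2) (_ : TorusSite 2 L) => c) k 0 k‖ ≤ 2 * ‖c‖ := fun k => by
    simp only [Finset.sum_const, Finset.card_univ, Fintype.card_fin, nsmul_eq_mul, Nat.cast_ofNat, norm_mul, Complex.norm_ofNat, le_refl]
  have hc := klms_member_direct_signed_le_genTCC β μ K B hR hK hAb hA hA20 hμ n ht hβ hn hM Φ hΦ Wd hWd hj x y hlo hhi hq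
    (fun _ _ _ => c) (fun _ _ _ => c) (A₀ := 2 * ‖c‖) (Kg := 0) (ε := 0) (by positivity) le_rfl le_rfl
    (fun k => h2c k) (fun k k' => by simp) (fun k => h2c k) (fun k k' => by simp) (Lc := fun _ => (0 : ℝ)) hαβ (fun _ => le_rfl) hr hserve hcover
    (fun _ k _ k' _ => by simp) (fun _ k _ k' _ => by simp) (fun i σ k k' _ => by simp)
  rw [zero_mul, add_zero, klmsRowBoundTCC_zero_cells] at hc
  have eR := klmsRowBoundTCC_add B.Dtmin A (4 + 8 / 3 * R.Gfr 1 * U ^ 2) (2 * ‖c‖) 0 0 0 A₁ Kg (∑ c, Lc c * (βc c - αc c))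
    (∑ c, (2 * Lc c + 4 * Kg) * (Real.pi / L) * (βc c - αc c)) β n j ((4 + 8 / 3 * R.Gfr 1 * U ^ 2) * klTorusNorm L (x - y)) L
  rw [zero_add, zero_add, zero_add] at eR
  have h1 := klms_member_direct_signed_le_genTCC β μ K B hR hK hAb hA hA20 hμ n ht hβ hn hM Φ hΦ Wd hWd hj x y hlo hhi hq F₁ F₁₀
    hA1 hKg hε1 hY0p₁ hY1p₁ hY0m₁ hY1m₁ hαβ hLc hr hserve hcover hcellp hcellm hflat₁
  have hw : ∀ k : FreqMomentum L M, 0 ≤ Φ j t k ∧ Φ j t k ≤ 1 - hubbardCutoffWeightCT L M β μ K (klScale klE0 n) k := fun k => by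
    rw [hΦ]; exact klmf_runningSymbol_mem L M β μ K n (isSoftSymbol_compl β μ K hj).1 ht k
  have h2 := fun w => klms_weighted_direct_norm_le_of_support_soft β μ K hK hβ hβL n n ht hw Wd hWd (F₂ w) x y (cen w) (hρ w) (hA2 w) (hF₂ w) (hsupp₂ w)
  have h2s := (norm_sum_le _ _).trans (Finset.sum_le_sum fun w (_ : w ∈ Finset.univ) => h2 w)
  refine ((norm_add_le _ _).trans (add_le_add ((norm_add_le _ _).trans (add_le_add hc h1)) h2s)).trans (le_of_eq ?_)
  rw [← eR]
  ring

/-- **MEMBER CROSSED ROW, CELL SPLIT `V_j⊗V_j = c + F₁ + Σ_w F₂ʷ`** (`n+1 ≤ j`, window `G|p_{Q_m−x−y}| ≤ Λₙ₊₁/8`, `16π/β ≤ Λₙ₊₁`): `c` constant (same row shape),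
`F₁` with data `(A₁, K_g, angular cells, ε₁)`, a finite window family `F₂ʷ` ⟹ `‖S_{Φ,x}‖ ≤ c-row + (F₁-row(cells) + ε₁·flat) +
Σ_w A₂ʷ·(256/3)(βL²)²/Λ(t)²·(2·(15381(ρ_w/π + 1/L)·Λₙ·βL²))`. -/
theorem member_crossed_signed_le_splitCellsC (hR : ∀ j, 0 ≤ R.Gfr j) (hK : FrameOK R U N μ K)
    (hAb : ∀ p : Momentum, ∀ j ≤ 2, ‖iteratedFDeriv ℝ j (frameShift K) p‖ ≤ A) (hA : 4 * A < B.Dtmin) (hA20 : 4 * A ≤ 1 / 20) (hμ : μ ≤ -0.15)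
    (n : ℕ) {t : ℝ} (ht : t ∈ Icc (0 : ℝ) 1) (hβ : klBetaMin ≤ β) (hβL : β ≤ L) (hn : n + 1 ≤ nScales β + 1) (hβn : 16 * π / β ≤ klScale klE0 (n + 1))
    (hM : β * (4 * klScale klE0 (n + 1)) / (2 * Real.pi) + 1 ≤ M)
    (Φ : ℕ → ℝ → FreqMomentum L M → ℝ) (hΦ : Φ = fun j t k => (softSymbolCompl L M β μ K (n + 1) j) k + (hubbardCutoffWeightCT L M β μ K (klScale klE0 (n + 1)) k -
            hubbardCutoffWeightCT L M β μ K (klScale klE0 n + t * (klScale klE0 (n + 1) - klScale klE0 n)) k))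
    (Wd : ℝ → FreqMomentum L M → ℝ) (hWd : Wd = fun t k => deriv (fun Λ' : ℝ => hubbardCutoffWeightCT L M β μ K Λ' k) (klScale klE0 n + t * (klScale klE0 (n + 1) - klScale klE0 n)))
    (V : ℕ → ℝ → (Fin 4 → HubbardFieldIdx L M) → ℂ) {j : ℕ} (hj : n + 1 ≤ j) (Qm x y : TorusSite 2 L)
    (hlo : a' < μ - 4 * klScale klE0 (n + 1) - 4 * A) (hhi : μ + 4 * klScale klE0 (n + 1) + 4 * A < b')
    (hq : (4 + 8 / 3 * R.Gfr 1 * U ^ 2) * klTorusNorm L (Qm - x - y) ≤ klScale klE0 (n + 1) / 8)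
    (c : ℂ) (F₁ : FreqMomentum L M → FreqMomentum L M → ℂ) {ι' : Type*} [Fintype ι'] (F₂ : ι' → FreqMomentum L M → FreqMomentum L M → ℂ)
    (F₁₀ : TorusSite 2 L → TorusSite 2 L → ℂ)
    (hsplit : ∀ (p p' : FreqMomentum L M),
      V j t ![((p, 0), 1), ((p', 1), 0), (((omega0 M, y), 0), 0), ((((omega0 M).rev, Qm - x), 1), 1)] *
          V j t ![((p, 0), 0), ((p', 1), 1), ((((omega0 M).rev, Qm - y), 1), 0), (((omega0 M, x), 0), 1)] = c + F₁ p p' + ∑ w, F₂ w p p')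
    {A₁ Kg ε₁ : ℝ} (hA1 : 0 ≤ A₁) (hKg : 0 ≤ Kg) (hε1 : 0 ≤ ε₁)
    (hY0B₁ : ∀ k : TorusSite 2 L, ‖F₁₀ k (k + (Qm - x - y))‖ ≤ A₁)
    (hY1B₁ : ∀ k k' : TorusSite 2 L, ‖F₁₀ k (k + (Qm - x - y)) - F₁₀ k' (k' + (Qm - x - y))‖ ≤ Kg * klTorusNorm L (k - k'))
    (hY0A₁ : ∀ k : TorusSite 2 L, ‖F₁₀ (k + -(Qm - x - y)) k‖ ≤ A₁)
    (hY1A₁ : ∀ k k' : TorusSite 2 L, ‖F₁₀ (k + -(Qm - x - y)) k - F₁₀ (k' + -(Qm - x - y)) k'‖ ≤ Kg * klTorusNorm L (k - k'))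
    {ι : Type*} [Fintype ι] {S : ι → Finset (TorusSite 2 L)} {αc βc Lc : ι → ℝ} (hαβ : ∀ c, αc c ≤ βc c) (hLc : ∀ c, 0 ≤ Lc c)
    {r : ℝ} (hr : 4 * klScale klE0 (n + 1) / (B.Dtmin - 4 * A) + Real.pi / L ≤ r)
    (hserve : ∀ c, ∀ θ ∈ Icc (αc c) (βc c), ∀ k : TorusSite 2 L,
      torusSupNorm (klpeP L k -
        (perturbedFermiRadius (fun k : Fin 2 → ℝ => frameShift K (WithLp.toLp 2 k)) μ θ * Real.cos θ,
          perturbedFermiRadius (fun k : Fin 2 → ℝ => frameShift K (WithLp.toLp 2 k)) μ θ * Real.sin θ)) ≤ r → k ∈ S c)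
    (hcover : ∀ θ ∈ Ioo (-π) π, ∃ c, θ ∈ Icc (αc c) (βc c))
    (hcellB : ∀ c, ∀ k ∈ S c, ∀ k' ∈ S c, ‖F₁₀ k (k + (Qm - x - y)) - F₁₀ k' (k' + (Qm - x - y))‖ ≤ Lc c * klTorusNorm L (k - k'))
    (hcellA : ∀ c, ∀ k ∈ S c, ∀ k' ∈ S c, ‖F₁₀ (k + -(Qm - x - y)) k - F₁₀ (k' + -(Qm - x - y)) k'‖ ≤ Lc c * klTorusNorm L (k - k'))
    (hflat₁ : ∀ (i i' : MatsubaraIdx M) (k k' : TorusSite 2 L), matsubaraInt M i' + 1 = matsubaraInt M i →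
      matsubaraFreq β M i ^ 2 ≤ (5 * klScale klE0 (n + 1)) ^ 2 → ‖F₁ (i, k) (i', k') - F₁₀ k k'‖ ≤ ε₁)
    (cen : ι' → TorusSite 2 L) {ρ A₂ : ι' → ℝ} (hρ : ∀ w, 0 ≤ ρ w) (hA2 : ∀ w, 0 ≤ A₂ w)
    (hF₂ : ∀ w (p p' : FreqMomentum L M), ‖F₂ w p p'‖ ≤ A₂ w)
    (hsupp₂ : ∀ w (p p' : FreqMomentum L M), ρ w < klTorusNorm L (p.2 - cen w) → F₂ w p p' = 0) :
    ‖∑ p : FreqMomentum L M, ∑ p' : FreqMomentum L M,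
        if matsubaraInt M p'.1 + matsubaraInt M (omega0 M) + matsubaraInt M (omega0 M) + 1 = matsubaraInt M p.1 ∧ p'.2 = p.2 + Qm - x - y then
          ((((((Φ j t p) : ℝ) : ℂ) * (((β * (L : ℝ) ^ 2 : ℝ) : ℂ) * propCT L M β μ K p)) * ((((Wd t p') : ℝ) : ℂ) * (((β * (L : ℝ) ^ 2 : ℝ) : ℂ) * propCT L M β μ K p'))) +
              (((((Wd t p) : ℝ) : ℂ) * (((β * (L : ℝ) ^ 2 : ℝ) : ℂ) * propCT L M β μ K p)) * ((((Φ j t p') : ℝ) : ℂ) * (((β * (L : ℝ) ^ 2 : ℝ) : ℂ) * propCT L M β μ K p')))) *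
            (V j t ![((p, 0), 1), ((p', 1), 0), (((omega0 M, y), 0), 0), ((((omega0 M).rev, Qm - x), 1), 1)] *
              V j t ![((p, 0), 0), ((p', 1), 1), ((((omega0 M).rev, Qm - y), 1), 0), (((omega0 M, x), 0), 1)])
        else 0‖ ≤
      ((β * (L : ℝ) ^ 2) ^ 2 *
          (β * (L : ℝ) ^ 2 * klmsRowBoundTCC B.Dtmin A (4 + 8 / 3 * R.Gfr 1 * U ^ 2) (‖c‖ + A₁) Kg (∑ c, Lc c * (βc c - αc c))
              (∑ c, (2 * Lc c + 4 * Kg) * (Real.pi / L) * (βc c - αc c)) β n j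
              (|-(2 * π / β)| + (4 + 8 / 3 * R.Gfr 1 * U ^ 2) * klTorusNorm L (Qm - x - y)) L +
            β * (L : ℝ) ^ 2 * klmsRowBoundTCC B.Dtmin A (4 + 8 / 3 * R.Gfr 1 * U ^ 2) (‖c‖ + A₁) Kg (∑ c, Lc c * (βc c - αc c))
              (∑ c, (2 * Lc c + 4 * Kg) * (Real.pi / L) * (βc c - αc c)) β n j
              (|2 * π / β| + (4 + 8 / 3 * R.Gfr 1 * U ^ 2) * klTorusNorm L (Qm - x - y)) L) +
        ε₁ * (256 / 3 * (β * (L : ℝ) ^ 2) ^ 2 / (klScale klE0 n + t * (klScale klE0 (n + 1) - klScale klE0 n)) ^ 2 *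
          ∑ p : FreqMomentum L M, |Φ j t p| * ‖propCT L M β μ K p‖)) +
      ∑ w, A₂ w * (256 / 3 * (β * (L : ℝ) ^ 2) ^ 2 / (klScale klE0 n + t * (klScale klE0 (n + 1) - klScale klE0 n)) ^ 2 *
        (2 * (15381 * (ρ w / π + ((L : ℝ))⁻¹) * klScale klE0 n * β * (L : ℝ) ^ 2))) := by
  -- (1) split the kernel twice
  set P : FreqMomentum L M → FreqMomentum L M → Prop := fun p p' =>
    matsubaraInt M p'.1 + matsubaraInt M (omega0 M) + matsubaraInt M (omega0 M) + 1 = matsubaraInt M p.1 ∧ p'.2 = p.2 + Qm - x - y with hP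
  set ln : FreqMomentum L M → FreqMomentum L M → ℂ := fun p p' =>
    (((((Φ j t p) : ℝ) : ℂ) * (((β * (L : ℝ) ^ 2 : ℝ) : ℂ) * propCT L M β μ K p)) * ((((Wd t p') : ℝ) : ℂ) * (((β * (L : ℝ) ^ 2 : ℝ) : ℂ) * propCT L M β μ K p'))) +
      (((((Wd t p) : ℝ) : ℂ) * (((β * (L : ℝ) ^ 2 : ℝ) : ℂ) * propCT L M β μ K p)) * ((((Φ j t p') : ℝ) : ℂ) * (((β * (L : ℝ) ^ 2 : ℝ) : ℂ) * propCT L M β μ K p'))) with hln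
  have e := (((pinned_crossed_sum_kernel_congr P ln hsplit).trans (pinned_crossed_sum_kernel_add P ln (fun p p' => c + F₁ p p') (fun p p' => ∑ w, F₂ w p p'))).trans
    (congrArg (· + _) (pinned_crossed_sum_kernel_add P ln (fun _ _ => c) F₁))).trans (congrArg (_ + ·) (pinned_crossed_sum_kernel_sum P ln F₂))
  simp only [hP, hln] at e
  rw [e]
  -- (2) the three rows
  have hc := klms_member_crossed_signed_le_genTCC β μ K B hR hK hAb hA hA20 hμ n ht hβ hn hβn hM Φ hΦ Wd hWd hj Qm x y hlo hhi hq
    (fun _ _ => c) (fun _ _ => c) (A₀ := ‖c‖) (Kg := 0) (ε := 0) (norm_nonneg c) le_rfl le_rfl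
    (fun k => le_rfl) (fun k k' => by simp) (fun k => le_rfl) (fun k k' => by simp) (Lc := fun _ => (0 : ℝ)) hαβ (fun _ => le_rfl) hr hserve hcover
    (fun _ k _ k' _ => by simp) (fun _ k _ k' _ => by simp) (fun i i' k k' _ _ => by simp)
  rw [zero_mul, add_zero, klmsRowBoundTCC_zero_cells, klmsRowBoundTCC_zero_cells] at hc
  have eRm := klmsRowBoundTCC_add B.Dtmin A (4 + 8 / 3 * R.Gfr 1 * U ^ 2) ‖c‖ 0 0 0 A₁ Kg (∑ c, Lc c * (βc c - αc c))
    (∑ c, (2 * Lc c + 4 * Kg) * (Real.pi / L) * (βc c - αc c)) β n j (|-(2 * π / β)| + (4 + 8 / 3 * R.Gfr 1 * U ^ 2) * klTorusNorm L (Qm - x - y)) L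
  have eRp := klmsRowBoundTCC_add B.Dtmin A (4 + 8 / 3 * R.Gfr 1 * U ^ 2) ‖c‖ 0 0 0 A₁ Kg (∑ c, Lc c * (βc c - αc c))
    (∑ c, (2 * Lc c + 4 * Kg) * (Real.pi / L) * (βc c - αc c)) β n j (|2 * π / β| + (4 + 8 / 3 * R.Gfr 1 * U ^ 2) * klTorusNorm L (Qm - x - y)) L
  rw [zero_add, zero_add, zero_add] at eRm eRp
  have h1 := klms_member_crossed_signed_le_genTCC β μ K B hR hK hAb hA hA20 hμ n ht hβ hn hβn hM Φ hΦ Wd hWd hj Qm x y hlo hhi hq F₁ F₁₀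
    hA1 hKg hε1 hY0B₁ hY1B₁ hY0A₁ hY1A₁ hαβ hLc hr hserve hcover hcellB hcellA hflat₁
  have hw : ∀ k : FreqMomentum L M, 0 ≤ Φ j t k ∧ Φ j t k ≤ 1 - hubbardCutoffWeightCT L M β μ K (klScale klE0 n) k := fun k => by
    rw [hΦ]; exact klmf_runningSymbol_mem L M β μ K n (isSoftSymbol_compl β μ K hj).1 ht k
  have h2 := fun w => klms_weighted_crossed_norm_le_of_support_soft β μ K hK hβ hβL n n ht hw Wd hWd (F₂ w) Qm x y (cen w) (hρ w) (hA2 w) (hF₂ w)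
    (hsupp₂ w)
  have h2s := (norm_sum_le _ _).trans (Finset.sum_le_sum fun w (_ : w ∈ Finset.univ) => h2 w)
  refine ((norm_add_le _ _).trans (add_le_add ((norm_add_le _ _).trans (add_le_add hc h1)) h2s)).trans (le_of_eq ?_)
  rw [← eRm, ← eRp]
  ring

end Model

end Summit.HubbardSuperconductivity.HubbardSuperconductivity.Theorems.KLRegimeSplit

end
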